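import Literature.AnabelianGeometry.SemiGraphs.ArithSemiGraphGaloisNonVacuity
import Summits.ABC.IUTFork.MLFGaloisTFG
import HarnessLib

/-!
# [SemiAnbd] Def. 5.1 (ii): `ArithSemiGraph` with arithmetic component `G_K` (`K/ℚ_p` finite) —
# UNCONDITIONAL (Summits-side assembly)

Cell `abc-iut` (run/shared/lean/pub/abc-iut/), layer L3 NV lane, seat abc-iut-w6-d108 (row
«ArithSemiGraph-GQp», abc-iut-L3-lead (gen 5) α63).  PROOF-ONLY (no `def`, no `instance`, no named fact).
The Literature file `ArithSemiGraphGaloisNonVacuity.lean` (p433585) inhabits the record `ArithSemiGraph`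
of [SemiAnbd] Def. 5.1 (ii) [cite: MochizukiSemiAnbd2006, Def 5.1 (ii), p. 62] over the real vocabulary
`SemiAnbdVocab.ofReal R` with the GENUINE arithmetic component `π̂₁(A) := G_K` (slim by
`galoisMLF_slim_holds`), carrying Def 5.1 (i)(a) "`G_K` topologically finitely generated" either as an
explicit hypothesis or modulo the named fact `localEulerPoincareCharacteristic` — because that fact is
proved only Summits-side.  Here the hypothesis is DISCHARGED by abc-iut-L4-d1's unconditional
`Summit.ABC.IUTFork.isTopologicallyFinitelyGenerated_absoluteGaloisGroup_padic` (p421667; GAP row G-L4t4-2),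
exactly as `MLFGaloisTFG.lean` does for [AbsTopI] Thm 2.6 (ii).

HONEST LABEL: genuine arithmetic GROUP `G_K`, trivial ACTION on the one-vertex edgeless Example 2.10 model
(abc-iut-w6-d117) — the input shape of `StableReductionTower.arithEmb`, not the arithmetic semi-graph of
anabelioids of a pointed stable curve (Example 5.6).  Nothing here asserts anything about abc or takes a
side on [IUTchIII] Cor. 3.12; instantiated ≠ endorsed.
-/

noncomputable section

namespace Summit.ABC.IUTFork

open _root_.CategoryTheory Field
open Literature.AnabelianGeometry.SemiGraphs
open Literature.AnabelianGeometry.SemiGraphs.SgAQuot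

/-- **`ArithSemiGraph (SemiAnbdVocab.ofReal R)` with `π̂₁(A) := G_K`, UNCONDITIONALLY**, for every finite
extension `K` of `ℚ_p` (in characteristic `0`): Def 5.1 (i)(a) by
`isTopologicallyFinitelyGenerated_absoluteGaloisGroup_padic`, slimness by `galoisMLF_slim_holds`, trivial
action on the one-vertex edgeless Example 2.10 model. [cite: MochizukiSemiAnbd2006, Def 5.1 (ii), p. 62] -/
theorem arithSemiGraph_exists_ofReal_absoluteGaloisGroup (R : SgA.BridgeResidual.{0, 1, 0})
    (p : ℕ) [Fact p.Prime] (K : Type) [Field K] [Algebra ℚ_[p] K] [FiniteDimensional ℚ_[p] K]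
    [CharZero K] :
    ∃ 𝔊 : ArithSemiGraph (SemiAnbdVocab.ofReal R),
      𝔊.PA = ProfiniteGrp.of (absoluteGaloisGroup K) ∧ 𝔊.ρ = 1 ∧
        Nonempty (Unique ((SemiAnbdVocab.ofReal R).Vert 𝔊.G)) ∧ IsEmpty ((SemiAnbdVocab.ofReal R).Edge 𝔊.G) :=
  ArithSemiGraph.exists_ofReal_absoluteGaloisGroup_of_tfg R p K
    (isTopologicallyFinitelyGenerated_absoluteGaloisGroup_padic p K)

/-- **`ArithSemiGraph` with `π̂₁(A) := G_{ℚ_p}`, UNCONDITIONALLY** — Def. 5.1's motivating slim, infinite,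
topologically finitely generated arithmetic component, over the tree's own vocabulary.
[cite: MochizukiSemiAnbd2006, Def 5.1 (ii), p. 62] -/
theorem arithSemiGraph_exists_ofReal_GQp (R : SgA.BridgeResidual.{0, 1, 0}) (p : ℕ) [Fact p.Prime] :
    ∃ 𝔊 : ArithSemiGraph (SemiAnbdVocab.ofReal R), 𝔊.PA = ProfiniteGrp.of (absoluteGaloisGroup ℚ_[p]) ∧ 𝔊.ρ = 1 :=
  ArithSemiGraph.exists_ofReal_GQp_of_tfg R p (isTopologicallyFinitelyGenerated_absoluteGaloisGroup_padic p ℚ_[p])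

/-- In particular, at abc-iut-w4-d082's degenerate bridge residual: an `ArithSemiGraph` with
`π̂₁(A) = G_{ℚ_p}` EXISTS over an inhabited instance of the container — no hypothesis left.
[cite: MochizukiSemiAnbd2006, Def 5.1 (ii), p. 62] -/
theorem arithSemiGraph_exists_ofReal_trivialResidual_GQp (p : ℕ) [Fact p.Prime] :
    ∃ 𝔊 : ArithSemiGraph (SemiAnbdVocab.ofReal SgA.BridgeResidual.trivial.{0, 1, 0}),
      𝔊.PA = ProfiniteGrp.of (absoluteGaloisGroup ℚ_[p]) ∧ 𝔊.ρ = 1 :=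
  arithSemiGraph_exists_ofReal_GQp _ p

/-- **`ArithSemiGraph` with arithmetic component ANY OPEN SUBGROUP `U ≤ G_K`, UNCONDITIONALLY** (appended,
same row α63): the Literature producer `ArithSemiGraph.exists_ofReal_openSubgroup_absoluteGaloisGroup_of_tfg`
with Def 5.1 (i)(a) for `G_K` discharged by p421667 — `π̂₁(A) := U` together with the continuous injective
homomorphism `π̂₁(A) → G_K` of range `U`, i.e. the three `arithEmb` fields of `StableReductionTower` at one
level ([SemiAnbd] Example 5.6: "`π̂₁(A_i) = M_i/N_i ⊆ G_K`"); trivial action on the one-vertex model,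
honestly. [cite: MochizukiSemiAnbd2006, Ex 5.6, p. 67] -/
theorem arithSemiGraph_exists_ofReal_openSubgroup_absoluteGaloisGroup (R : SgA.BridgeResidual.{0, 1, 0})
    (p : ℕ) [Fact p.Prime] (K : Type) [Field K] [Algebra ℚ_[p] K] [FiniteDimensional ℚ_[p] K]
    [CharZero K] (U : Subgroup (absoluteGaloisGroup K)) (hU : IsOpen (U : Set (absoluteGaloisGroup K))) :
    ∃ (𝔊 : ArithSemiGraph (SemiAnbdVocab.ofReal R)) (e : 𝔊.PA →ₜ* absoluteGaloisGroup K),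
      Function.Injective e ∧ e.toMonoidHom.range = U ∧ 𝔊.ρ = 1 ∧
        Nonempty (Unique ((SemiAnbdVocab.ofReal R).Vert 𝔊.G)) ∧ IsEmpty ((SemiAnbdVocab.ofReal R).Edge 𝔊.G) :=
  ArithSemiGraph.exists_ofReal_openSubgroup_absoluteGaloisGroup_of_tfg R p K
    (isTopologicallyFinitelyGenerated_absoluteGaloisGroup_padic p K) U hU

end Summit.ABC.IUTFork

end
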